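import Mathlib.Analysis.Calculus.Deriv.Slope
import Mathlib.Analysis.Convex.Segment
import Mathlib.Topology.Piecewise
import Literature.Topology.PlaneTopology.ArgumentIncrement
import HarnessLib

/-!
# The jump of the winding number across a transversal crossing of a differentiable loop

Topic: Topology / PlaneTopology (companion to `WindingNumber.lean`, `ArgumentIncrement.lean`).
`ArgumentIncrement.lean` computes the jump `±1` of the winding number of a loop across a
*straight* piece crossed transversally by a segment. This file transfers the computation to loops
that are merely differentiable at the crossing point, as needed for smooth plane curves (Gauss's
parity theorem for the crossings of a closed normal curve, `Literature/Topology/FourManifolds`):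

* `exists_mem_segment_mem_openSegment` — two segments whose endpoints are strictly separated by
  each other's lines meet (elementary plane geometry of the side functional `segSide`);
* `wind_affine_sub_eq_of_norm_sub_lt`, `wind_affine_sub_eq_of_path`,
  `wind_affine_sub_eq_of_segment` — Rouché's principle and local constancy in the point for loops
  read on an interval `[a, b]` (the winding number `wind (L - p)` does not change when `p` moves
  along a path or a segment missing the loop; `wind_sub_eq_of_mem_connectedComponentIn`);
* `wind_sub_wind_of_straight_cross` — for a loop `L` on `[a, b]` which is straight on `[u, u']`,
  avoids the segment `[ℓ, r]` outside `(u, u')`, and whose straight piece crosses `[ℓ, r]` from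
  the positive to the negative side, `wind (L - ℓ) - wind (L - r) = 1` (bookkeeping of continuous
  logarithms of `(L - ℓ)/(L - r)` on the three pieces, `logInc_crossRatioFn_lineMap_of_cross`);
* `wind_sub_wind_of_hasDerivAt_cross` — **the jump across a transversal crossing**: if the loop
  `L` is differentiable at an interior parameter `s₀` with velocity `v`, passes through
  `c = L s₀` only once, and a path `R` passes through `c` at time `t₀` with velocity `w`,
  `Im (v conj w) > 0`, then for all small `ε > 0` the points `R (t₀ ∓ ε)` are off the loop and
  `wind (L - R (t₀ - ε)) - wind (L - R (t₀ + ε)) = 1` (straighten `L` near `s₀` by its chord,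
  which changes neither winding number by Rouché's principle, `wind_sub_wind_of_chord_estimates`,
  and apply the previous statement); `wind_sub_wind_of_hasDerivAt_cross'` is the version for
  either sign of `Im (v conj w)`, with conclusion `= ±1`;
* `wind_sub_eq_of_corner` — **the corner of a loop at a transversal double point**: if `γ` on
  `[a, b]` closes up only at its ends, with independent velocities at `a` and `b`, then for all
  small `ε > 0` the loop `γ [a, b]` has the same winding number about `γ (b + ε)` and
  `γ (a - ε)` (the segment joining them misses the loop, `segment_disjoint_of_corner_estimates`).

All statements are folklore (Ahlfors, *Complex Analysis*, 3rd ed. (1979), §4.2.1, Lemma 2: the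
winding number is constant on the complementary components and jumps by `±1` across an arc;
here for a differentiable transversal crossing). Everything is proved; loops are maps `ℝ → ℂ`
read on `[a, b]` and reparametrised affinely by `[0, 1]` for `wind`.

## References

* L. V. Ahlfors, *Complex Analysis*, 3rd ed., McGraw-Hill (1979), §4.2.1. [cite: Ahlfors1979, §4.2.1]
-/

noncomputable section

open Complex Set Filter Topology Asymptotics
open scoped Real ComplexConjugate

namespace Literature.Topology.PlaneTopology

/-! ### Elementary plane geometry of the side functional -/

/-- The side functional in coordinates: `segSide ℓ r z = Im (z - ℓ) Re (z - r) - Re (z - ℓ) Im (z - r)`.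
[folklore] -/
theorem segSide_eq (ℓ r z : ℂ) :
    segSide ℓ r z = (z - ℓ).im * (z - r).re - (z - ℓ).re * (z - r).im := by
  simp only [segSide, mul_im, conj_re, conj_im]
  ring

/-- The side functional is invariant under translations and homogeneous of degree two under
dilations. [folklore] -/
theorem segSide_translate_smul (c ℓ r z : ℂ) (ε : ℝ) :
    segSide (c + ε • ℓ) (c + ε • r) (c + ε • z) = ε ^ 2 * segSide ℓ r z := by
  rw [segSide_eq, segSide_eq]
  simp only [add_sub_add_left_eq_sub, ← smul_sub, Complex.smul_re, Complex.smul_im, smul_eq_mul]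
  ring

/-- The side functional is continuous in all three arguments. [folklore] -/
theorem continuous_segSide₃ : Continuous fun p : ℂ × ℂ × ℂ => segSide p.1 p.2.1 p.2.2 := by
  simp only [segSide_eq]
  fun_prop

/-- A point at which the side functional of `[ℓ, r]` vanishes lies on the line through `ℓ` and
`r`. [folklore] -/
theorem exists_eq_lineMap_of_segSide_eq_zero {ℓ r p : ℂ} (hlr : ℓ ≠ r) (h : segSide ℓ r p = 0) :
    ∃ μ : ℝ, p = AffineMap.lineMap ℓ r μ := by
  set x := p - ℓ with hx
  set d := r - ℓ with hd
  have hd0 : d ≠ 0 := sub_ne_zero.2 hlr.symm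
  have hxd : p - r = x - d := by rw [hx, hd]; ring
  rw [segSide_eq, ← hx, hxd] at h
  simp only [sub_re, sub_im] at h
  -- `h : x.im * (x.re - d.re) - x.re * (x.im - d.im) = 0`, i.e. `x.re * d.im = x.im * d.re`
  have hpar : x.re * d.im = x.im * d.re := by linarith
  have hdn : d.re * d.re + d.im * d.im ≠ 0 := by
    intro h0
    apply hd0
    have hre : d.re = 0 := by nlinarith
    have him : d.im = 0 := by nlinarith
    exact Complex.ext hre him
  set N : ℝ := d.re * d.re + d.im * d.im with hN
  set μ : ℝ := (x.re * d.re + x.im * d.im) / N with hμ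
  have hre : μ * d.re = x.re := by
    rw [hμ, div_mul_eq_mul_div, div_eq_iff hdn]
    linear_combination (-d.im) * hpar
  have him : μ * d.im = x.im := by
    rw [hμ, div_mul_eq_mul_div, div_eq_iff hdn]
    linear_combination d.re * hpar
  have key : x = (μ : ℂ) * d := by
    apply Complex.ext
    · rw [mul_re, ofReal_re, ofReal_im, zero_mul, sub_zero, hre]
    · rw [mul_im, ofReal_re, ofReal_im, zero_mul, add_zero, him]
  have hp : p = x + ℓ := by rw [hx]; ring
  refine ⟨μ, ?_⟩
  rw [AffineMap.lineMap_apply_module', ← hd, real_smul, ← key, hp]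

/-- **Crossing segments.** If `A`, `B` lie strictly on the positive, resp. negative, side of
`[ℓ, r]`, and `ℓ`, `r` lie strictly on the negative, resp. positive, side of `[A, B]`, then the
segment `[A, B]` meets the open segment `(ℓ, r)`. [folklore] -/
theorem exists_mem_segment_mem_openSegment {ℓ r A B : ℂ} (hA : 0 < segSide ℓ r A)
    (hB : segSide ℓ r B < 0) (hl : segSide A B ℓ < 0) (hr : 0 < segSide A B r) :
    ∃ p ∈ segment ℝ A B, p ∈ openSegment ℝ ℓ r := by
  have hlr : ℓ ≠ r := ne_of_segSide_ne_zero hA.ne'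
  set τ : ℝ := segSide ℓ r A / (segSide ℓ r A - segSide ℓ r B) with hτ
  have hden : 0 < segSide ℓ r A - segSide ℓ r B := by linarith
  have hτ0 : 0 ≤ τ := (div_pos hA hden).le
  have hτ1 : τ ≤ 1 := ((div_lt_one hden).2 (by linarith)).le
  set p : ℂ := AffineMap.lineMap A B τ with hp
  have hp0 : segSide ℓ r p = 0 := by
    rw [hp, segSide_lineMap, hτ]; field_simp; ring
  obtain ⟨μ, hμ⟩ := exists_eq_lineMap_of_segSide_eq_zero hlr hp0
  -- `p` is on the line `A B`, hence `segSide A B p = 0`, which locates `μ` strictly between `0, 1`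
  have hq : (1 - μ) * segSide A B ℓ + μ * segSide A B r = 0 := by
    rw [← segSide_lineMap, ← hμ, hp, segSide_lineMap, segSide_left, segSide_right]; ring
  have hμ0 : 0 < μ := by
    by_contra h0
    push Not at h0
    nlinarith
  have hμ1 : μ < 1 := by
    by_contra h1
    push Not at h1
    nlinarith
  refine ⟨p, ?_, ?_⟩
  · rw [hp, segment_eq_image_lineMap]
    exact ⟨τ, ⟨hτ0, hτ1⟩, rfl⟩
  · rw [hμ, openSegment_eq_image_lineMap]
    exact ⟨μ, ⟨hμ0, hμ1⟩, rfl⟩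

/-- A segment with endpoints in a closed ball lies in the ball. [folklore] -/
theorem norm_sub_le_of_mem_segment {ℓ r c z : ℂ} {ρ : ℝ} (hl : ‖ℓ - c‖ ≤ ρ) (hr : ‖r - c‖ ≤ ρ)
    (hz : z ∈ segment ℝ ℓ r) : ‖z - c‖ ≤ ρ := by
  have hseg := (convex_closedBall c ρ).segment_subset (mem_closedBall_iff_norm.2 hl)
    (mem_closedBall_iff_norm.2 hr) hz
  exact mem_closedBall_iff_norm.1 hseg

/-! ### Transversality algebra -/

/-- `Im ((α v + β w) conj v) = β Im (w conj v)` for real `α, β`. [folklore] -/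
theorem im_add_smul_mul_conj (v w : ℂ) (α β : ℝ) :
    ((α • v + β • w) * conj v).im = β * (w * conj v).im := by
  simp only [real_smul, mul_im, add_re, add_im, mul_re, ofReal_re, ofReal_im, zero_mul, sub_zero,
    add_zero, conj_re, conj_im]
  ring

/-- `Im (w conj v) = - Im (v conj w)`. [folklore] -/
theorem im_mul_conj_swap (v w : ℂ) : (w * conj v).im = -(v * conj w).im := by
  simp only [mul_im, conj_re, conj_im]; ring

/-- `|Im (z conj v)| ≤ ‖z‖ ‖v‖`. [folklore] -/
theorem abs_im_mul_conj_le (z v : ℂ) : |(z * conj v).im| ≤ ‖z‖ * ‖v‖ := by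
  calc |(z * conj v).im| ≤ ‖z * conj v‖ := Complex.abs_im_le_norm _
    _ = ‖z‖ * ‖v‖ := by rw [norm_mul, Complex.norm_conj]

/-- **Transversal separation.** For real `α, β` and `v ≠ 0`:
`|β| |Im (v conj w)| ≤ ‖α v + β w‖ ‖v‖` — the component of `α v + β w` across the line `ℝ v`
controls its norm from below. [folklore] -/
theorem abs_mul_abs_im_le_norm_add_smul (v w : ℂ) (α β : ℝ) :
    |β| * |(v * conj w).im| ≤ ‖α • v + β • w‖ * ‖v‖ := by
  have h := abs_im_mul_conj_le (α • v + β • w) v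
  rw [im_add_smul_mul_conj, im_mul_conj_swap, abs_mul, abs_neg] at h
  exact h

/-! ### Loops read on `[a, b]`: Rouché and local constancy in the point -/

/-- The affine reparametrisation `[0, 1] → [a, b]`. [folklore] -/
theorem mapsTo_affine {a b : ℝ} (hab : a ≤ b) :
    MapsTo (fun τ : ℝ => a + τ * (b - a)) (Icc 0 1) (Icc a b) := by
  intro τ hτ
  constructor <;> nlinarith [hτ.1, hτ.2, sub_nonneg.2 hab]

/-- **Rouché for loops on `[a, b]`.** If `‖L' s - L s‖ < ‖L s - p‖` along `[a, b]`, the loops `L`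
and `L'` have the same winding number about `p`. [folklore] -/
theorem wind_affine_sub_eq_of_norm_sub_lt {L L' : ℝ → ℂ} {a b : ℝ} (hab : a ≤ b) {p : ℂ}
    (hL : ContinuousOn L (Icc a b)) (hL' : ContinuousOn L' (Icc a b)) (h0 : L a = L b)
    (h0' : L' a = L' b) (h : ∀ s ∈ Icc a b, ‖L' s - L s‖ < ‖L s - p‖) :
    wind (fun τ => L' (a + τ * (b - a)) - p) = wind (fun τ => L (a + τ * (b - a)) - p) := by
  have hφ : Continuous fun τ : ℝ => a + τ * (b - a) := by fun_prop
  have hm := mapsTo_affine hab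
  refine wind_eq_of_norm_sub_lt ((hL'.comp hφ.continuousOn hm).sub continuousOn_const)
    (by simp [h0']) ⟨(hL.comp hφ.continuousOn hm).sub continuousOn_const,
      fun τ hτ h0τ => ?_, by simp [h0]⟩ fun τ hτ => ?_
  · have := h _ (hm hτ)
    rw [sub_eq_zero.1 h0τ, sub_self, norm_zero] at this
    exact (norm_nonneg _).not_gt this
  · simpa using h _ (hm hτ)

/-- **Local constancy in the point, along a path.** If a path `P` on `[c, d]` misses the loop
`L [a, b]`, then `L` has the same winding number about `P c` and `P d`. [folklore] -/
theorem wind_affine_sub_eq_of_path {L : ℝ → ℂ} {a b : ℝ} (hab : a ≤ b)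
    (hL : ContinuousOn L (Icc a b)) (h0 : L a = L b) {P : ℝ → ℂ} {c d : ℝ} (hcd : c ≤ d)
    (hP : ContinuousOn P (Icc c d)) (hPL : ∀ t ∈ Icc c d, P t ∉ L '' Icc a b) :
    wind (fun τ => L (a + τ * (b - a)) - P c) = wind (fun τ => L (a + τ * (b - a)) - P d) := by
  have hφ : Continuous fun τ : ℝ => a + τ * (b - a) := by fun_prop
  have hm := mapsTo_affine hab
  have hK : IsClosed (L '' Icc a b) := (isCompact_Icc.image_of_continuousOn hL).isClosed
  refine wind_sub_eq_of_mem_connectedComponentIn (hL.comp hφ.continuousOn hm) (by simp [h0])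
    hK (fun τ hτ => ⟨_, hm hτ, rfl⟩) ?_
  have hconn : IsPreconnected (P '' Icc c d) := isPreconnected_Icc.image P hP
  exact hconn.subset_connectedComponentIn ⟨c, left_mem_Icc.2 hcd, rfl⟩
    (by rintro _ ⟨t, ht, rfl⟩; exact hPL t ht) ⟨d, right_mem_Icc.2 hcd, rfl⟩

/-- **Local constancy in the point, along a segment.** If the segment `[p, q]` misses the loop
`L [a, b]`, then `L` has the same winding number about `p` and `q`. [folklore] -/
theorem wind_affine_sub_eq_of_segment {L : ℝ → ℂ} {a b : ℝ} (hab : a ≤ b)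
    (hL : ContinuousOn L (Icc a b)) (h0 : L a = L b) {p q : ℂ}
    (hpq : ∀ z ∈ segment ℝ p q, z ∉ L '' Icc a b) :
    wind (fun τ => L (a + τ * (b - a)) - p) = wind (fun τ => L (a + τ * (b - a)) - q) := by
  have h := wind_affine_sub_eq_of_path hab hL h0 zero_le_one
    (P := fun t : ℝ => AffineMap.lineMap p q t) AffineMap.lineMap_continuous.continuousOn
    (fun t ht => hpq _ (by rw [segment_eq_image_lineMap]; exact ⟨t, ht, rfl⟩))
  simpa using h

/-! ### The jump across a straight piece of a loop -/

/-- Two continuous logarithms of the same function on an interval have equal increments.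
[folklore] -/
theorem log_sub_log_eq_of_exp_eq {l m : ℝ → ℂ} {u u' : ℝ} (hl : ContinuousOn l (Icc u u'))
    (hm : ContinuousOn m (Icc u u')) (h : ∀ s ∈ Icc u u', exp (l s) = exp (m s)) (huu' : u ≤ u') :
    l u' - l u = m u' - m u := by
  obtain ⟨n, hn⟩ := exists_int_eq_add_of_exp_eq isPreconnected_Icc hl hm h
  rw [hn u' (right_mem_Icc.2 huu'), hn u (left_mem_Icc.2 huu')]
  ring

/-- **The jump across a straight piece.** Let the loop `L` on `[a, b]` be straight on
`[u, u'] ⊆ [a, b]` and avoid the segment `[ℓ, r]` outside `(u, u')`; suppose the straight piece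
runs from the positive to the negative side of `[ℓ, r]` and meets the open segment `(ℓ, r)`. Then
`wind (L - ℓ) - wind (L - r) = 1`: a continuous logarithm of `(L - ℓ)/(L - r)` on `[a, b]` gains
the principal-branch amounts on the two outer pieces and the principal-branch amount plus `2πi`
on the straight piece (`logInc_crossRatioFn_lineMap_of_cross`). [folklore] -/
theorem wind_sub_wind_of_straight_cross {L : ℝ → ℂ} {a u u' b : ℝ} {ℓ r : ℂ}
    (hau : a ≤ u) (huu' : u < u') (hu'b : u' ≤ b)
    (hL : ContinuousOn L (Icc a b)) (hab : L a = L b)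
    (hmid : ∀ s ∈ Icc u u', L s = AffineMap.lineMap (L u) (L u') ((s - u) / (u' - u)))
    (hout : ∀ s ∈ Icc a u ∪ Icc u' b, L s ∉ segment ℝ ℓ r)
    (hA : 0 < segSide ℓ r (L u)) (hB : segSide ℓ r (L u') < 0)
    (hx : ∃ p ∈ segment ℝ (L u) (L u'), p ∈ openSegment ℝ ℓ r) :
    wind (fun τ => L (a + τ * (b - a)) - ℓ) - wind (fun τ => L (a + τ * (b - a)) - r) = 1 := by
  obtain ⟨hlAB, hrAB⟩ := not_mem_segment_of_cross hA hB hx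
  have hd : 0 < u' - u := sub_pos.2 huu'
  -- `L` avoids `ℓ` and `r` on `[a, b]`
  have hmidseg : ∀ s ∈ Icc u u', L s ∈ segment ℝ (L u) (L u') := fun s hs => by
    rw [hmid s hs, segment_eq_image_lineMap]
    exact ⟨_, ⟨div_nonneg (sub_nonneg.2 hs.1) hd.le,
      (div_le_one hd).2 (sub_le_sub_right hs.2 _)⟩, rfl⟩
  have hne : ∀ s ∈ Icc a b, L s ≠ ℓ ∧ L s ≠ r := by
    intro s hs
    rcases le_or_gt s u with h1 | h1
    · have h := hout s (Or.inl ⟨hs.1, h1⟩)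
      exact ⟨fun h' => h (h' ▸ left_mem_segment _ _ _), fun h' => h (h' ▸ right_mem_segment _ _ _)⟩
    rcases le_or_gt u' s with h2 | h2
    · have h := hout s (Or.inr ⟨h2, hs.2⟩)
      exact ⟨fun h' => h (h' ▸ left_mem_segment _ _ _), fun h' => h (h' ▸ right_mem_segment _ _ _)⟩
    · have hm := hmidseg s ⟨h1.le, h2.le⟩
      exact ⟨fun h' => hlAB (h' ▸ hm), fun h' => hrAB (h' ▸ hm)⟩
  -- the quotient `g = (L - ℓ)/(L - r)` and a logarithm `l` of it on `[a, b]`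
  set g : ℝ → ℂ := fun s => crossRatioFn ℓ r (L s) with hg
  have hgc : ContinuousOn g (Icc a b) := fun s hs =>
    (continuousAt_crossRatioFn (hne s hs).2).comp_continuousWithinAt (hL s hs)
  have hg0 : ∀ s ∈ Icc a b, g s ≠ 0 := fun s hs => crossRatioFn_ne_zero (hne s hs).1 (hne s hs).2
  obtain ⟨l, hl, hle⟩ := hasLogOn_Icc hgc hg0
  have hua : Icc u u' ⊆ Icc a b := Icc_subset_Icc hau hu'b
  -- (1) `l b - l a = 2πi (wind (L - ℓ) - wind (L - r))`
  have hφ : Continuous fun τ : ℝ => a + τ * (b - a) := by fun_prop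
  have hm := mapsTo_affine (hau.trans (huu'.le.trans hu'b))
  have hΛ : ContinuousOn (fun τ : ℝ => L (a + τ * (b - a))) (Icc 0 1) := hL.comp hφ.continuousOn hm
  have h1 : a + 1 * (b - a) = b := by ring
  have hloopl : IsNonvanishingLoop fun τ => L (a + τ * (b - a)) - ℓ :=
    ⟨hΛ.sub continuousOn_const, fun τ hτ h0 => (hne _ (hm hτ)).1 (sub_eq_zero.1 h0),
      by simp [hab]⟩
  have hloopr : IsNonvanishingLoop fun τ => L (a + τ * (b - a)) - r :=
    ⟨hΛ.sub continuousOn_const, fun τ hτ h0 => (hne _ (hm hτ)).2 (sub_eq_zero.1 h0),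
      by simp [hab]⟩
  have hdiv := wind_div hloopl hloopr
  have hspec := wind_spec (f := fun τ => (L (a + τ * (b - a)) - ℓ) / (L (a + τ * (b - a)) - r))
    (l := fun τ => l (a + τ * (b - a))) (hl.comp hφ.continuousOn hm) (fun τ hτ => hle _ (hm hτ))
    (by simp [hab])
  simp only [zero_mul, add_zero, h1] at hspec
  rw [hdiv] at hspec
  -- (2) the two outer pieces: the principal logarithm is a logarithm of `g` there
  have hslit : ∀ s ∈ Icc a u ∪ Icc u' b, g s ∈ slitPlane := fun s hs =>
    crossRatioFn_mem_slitPlane (hout s hs)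
  have hright : l b - l u' = log (g b) - log (g u') := by
    have hsub : Icc u' b ⊆ Icc a b := Icc_subset_Icc (hau.trans huu'.le) le_rfl
    refine log_sub_log_eq_of_exp_eq (hl.mono hsub) ((hgc.mono hsub).clog fun s hs =>
      hslit s (Or.inr hs)) (fun s hs => ?_) hu'b
    rw [hle s (hsub hs), exp_log (hg0 s (hsub hs))]
  have hleft : l u - l a = log (g u) - log (g a) := by
    have hsub : Icc a u ⊆ Icc a b := Icc_subset_Icc le_rfl (huu'.le.trans hu'b)
    refine log_sub_log_eq_of_exp_eq (hl.mono hsub) ((hgc.mono hsub).clog fun s hs =>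
      hslit s (Or.inl hs)) (fun s hs => ?_) hau
    rw [hle s (hsub hs), exp_log (hg0 s (hsub hs))]
  -- (3) the straight piece
  have hψ : Continuous fun t : ℝ => u + t * (u' - u) := by fun_prop
  have hmψ : MapsTo (fun t : ℝ => u + t * (u' - u)) (Icc 0 1) (Icc u u') := mapsTo_affine huu'.le
  have hmiddle : l u' - l u = log (g u') - log (g u) + 2 * π * I := by
    have key := logInc_crossRatioFn_lineMap_of_cross hA hB hx
    rw [logInc_eq (l := fun t => l (u + t * (u' - u))) (hl.comp hψ.continuousOn
      (hmψ.mono_right hua)) (fun t ht => ?_)] at key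
    · simpa using key
    · rw [hle _ (hua (hmψ ht)), hg]
      simp only
      rw [hmid _ (hmψ ht)]
      congr 2
      field_simp
      ring
  -- (4) summation
  have hsum : l b - l a = 2 * π * I := by
    have e : l b - l a = (l b - l u') + (l u' - l u) + (l u - l a) := by ring
    rw [e, hright, hmiddle, hleft]
    have hgab : g a = g b := by simp [hg, hab]
    rw [hgab]
    ring
  rw [hsum] at hspec
  have := int_eq_of_mul_two_pi_I_eq (m := 1)
    (n := wind (fun τ => L (a + τ * (b - a)) - ℓ) - wind (fun τ => L (a + τ * (b - a)) - r))
    (by push_cast; rw [one_mul]; exact_mod_cast hspec)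
  exact_mod_cast this.symm

/-! ### Quantitative lemmas for the straightening -/

/-- Quantitative differentiability: `‖f t - f x - (t - x) f'‖ ≤ θ |t - x|` for `t` near `x`.
[folklore] -/
theorem exists_forall_norm_sub_sub_mul_le {f : ℝ → ℂ} {f' : ℂ} {x : ℝ} (hf : HasDerivAt f f' x)
    {θ : ℝ} (hθ : 0 < θ) :
    ∃ δ > 0, ∀ t, |t - x| < δ → ‖f t - f x - ((t - x : ℝ) : ℂ) * f'‖ ≤ θ * |t - x| := by
  have h := hf.isLittleO.def hθ
  rw [Metric.eventually_nhds_iff] at h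
  obtain ⟨δ, hδ, h⟩ := h
  refine ⟨δ, hδ, fun t ht => ?_⟩
  have := h (by rwa [Real.dist_eq])
  simpa [Real.norm_eq_abs, Complex.real_smul] using this

/-- **Far points stay away.** If the loop `L` on `[a, b]` passes through `L s₀` only at `s₀`,
then the points `L s`, `|s - s₀| ≥ δ`, are at distance `≥ ρ > 0` from `L s₀` (compactness).
[folklore] -/
theorem exists_pos_forall_le_norm_sub {L : ℝ → ℂ} {a b s₀ δ : ℝ}
    (hL : ContinuousOn L (Icc a b)) (hinj : ∀ s ∈ Icc a b, L s = L s₀ → s = s₀) (hδ : 0 < δ) :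
    ∃ ρ > 0, ∀ s ∈ Icc a b, δ ≤ |s - s₀| → ρ ≤ ‖L s - L s₀‖ := by
  set T : Set ℝ := Icc a b ∩ {s | δ ≤ |s - s₀|} with hT
  have hTc : IsCompact T :=
    isCompact_Icc.inter_right (isClosed_le continuous_const (by fun_prop))
  rcases T.eq_empty_or_nonempty with hTe | hTne
  · refine ⟨1, one_pos, fun s hs hsδ => ?_⟩
    have h : s ∈ T := ⟨hs, hsδ⟩
    rw [hTe] at h
    exact h.elim
  · have hc : ContinuousOn (fun s => ‖L s - L s₀‖) T :=
      ((hL.mono inter_subset_left).sub continuousOn_const).norm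
    obtain ⟨s₁, hs₁, hmin⟩ := hTc.exists_isMinOn hTne hc
    have hpos : 0 < ‖L s₁ - L s₀‖ := by
      rw [norm_pos_iff, sub_ne_zero]
      intro h
      have h1 := hinj s₁ hs₁.1 h
      have h2 := hs₁.2
      simp only [mem_setOf_eq, h1, sub_self, abs_zero] at h2
      linarith
    exact ⟨_, hpos, fun s hs hsδ => (isMinOn_iff.1 hmin) s ⟨hs, hsδ⟩⟩

/-- Eventually `M ε < C` as `ε → 0⁺`, for `C > 0`. [folklore] -/
theorem eventually_mul_lt_nhdsGT {M C : ℝ} (hC : 0 < C) : ∀ᶠ ε in 𝓝[>] (0 : ℝ), M * ε < C := by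
  have ht : Tendsto (fun ε : ℝ => M * ε) (𝓝[>] 0) (𝓝 0) := by
    have h : Tendsto (fun ε : ℝ => M * ε) (𝓝 0) (𝓝 (M * 0)) :=
      (continuous_const.mul continuous_id).tendsto 0
    rw [mul_zero] at h
    exact h.mono_left nhdsWithin_le_nhds
  exact ht.eventually (eventually_lt_nhds hC)

/-- Rescaled one-sided slopes: `ε⁻¹ (f (x + m ε) - f x) → m f'` as `ε → 0⁺`. [folklore] -/
theorem tendsto_slope_comp_mul {f : ℝ → ℂ} {f' : ℂ} {x : ℝ} (hf : HasDerivAt f f' x) {m : ℝ}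
    (hm : m ≠ 0) :
    Tendsto (fun ε : ℝ => ε⁻¹ • (f (x + m * ε) - f x)) (𝓝[>] 0) (𝓝 (m • f')) := by
  have h1 : Tendsto (fun ε : ℝ => m * ε) (𝓝[>] 0) (𝓝[≠] 0) := by
    apply tendsto_nhdsWithin_of_tendsto_nhds_of_eventually_within
    · have h : Tendsto (fun ε : ℝ => m * ε) (𝓝 0) (𝓝 (m * 0)) :=
        (continuous_const.mul continuous_id).tendsto 0
      rw [mul_zero] at h
      exact h.mono_left nhdsWithin_le_nhds
    · filter_upwards [self_mem_nhdsWithin] with ε hε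
      exact mul_ne_zero hm (ne_of_gt hε)
  have h2 := (hf.tendsto_slope_zero.comp h1).const_smul m
  refine h2.congr' ?_
  filter_upwards [self_mem_nhdsWithin] with ε hε
  simp only [Function.comp_apply, smul_smul, mul_inv]
  rw [← mul_assoc, mul_inv_cancel₀ hm, one_mul]

/-! ### The jump across a transversal crossing of a differentiable loop -/

/-- **Straightening step, for a fixed scale.** Let the loop `L` on `[a, b]` pass through `c`
at `s₀` with the following estimates at scale `η` (chord) and `ε` (points), accuracy `θ`:
`L` is `θ`-close to the line `c + (s - s₀) v` on `|s - s₀| ≤ η`; the points `L s`,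
`|s - s₀| ≥ η`, are farther than `ε (‖w‖ + 1)` from `c`; the two points `ℓ`, `r` are `θ ε`-close
to `c ∓ ε w`; the line `c + ℝ v` stays `ε D/‖v‖` away from `c ∓ ε w` with
`3 θ η + θ ε < ε D/‖v‖`; and the chord `[L (s₀ - η), L (s₀ + η)]` crosses `[ℓ, r]` from the
positive to the negative side. Then `ℓ`, `r` are off the loop and
`wind (L - ℓ) - wind (L - r) = 1`: the loop straightened along the chord has the same winding
numbers about `ℓ` and `r` (Rouché, `wind_affine_sub_eq_of_norm_sub_lt`) and is handled by
`wind_sub_wind_of_straight_cross`. [folklore] -/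
theorem wind_sub_wind_of_chord_estimates {L : ℝ → ℂ} {a b s₀ η ε θ D : ℝ} {v w c ℓ r : ℂ}
    (hL : ContinuousOn L (Icc a b)) (hab : L a = L b)
    (hη0 : 0 < η) (hε0 : 0 < ε) (hθ0 : 0 ≤ θ) (hθ1 : θ ≤ 1) (hau : a < s₀ - η)
    (hub : s₀ + η < b) (hv : 0 < ‖v‖)
    (hLlin : ∀ s, |s - s₀| ≤ η → ‖L s - (c + ((s - s₀ : ℝ) : ℂ) * v)‖ ≤ θ * |s - s₀|)
    (hLfar : ∀ s ∈ Icc a b, η ≤ |s - s₀| → ε * (‖w‖ + 1) < ‖L s - c‖)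
    (eℓ : ‖ℓ - (c - (ε : ℂ) * w)‖ ≤ θ * ε) (er : ‖r - (c + (ε : ℂ) * w)‖ ≤ θ * ε)
    (hsep : ∀ x σ : ℝ, |σ| = ε → ε * D ≤ ‖(x : ℂ) * v + (σ : ℂ) * w‖ * ‖v‖)
    (hgap : 2 * θ * η + θ * η + θ * ε < ε * D / ‖v‖)
    (sA : 0 < segSide ℓ r (L (s₀ - η))) (sB : segSide ℓ r (L (s₀ + η)) < 0)
    (sl : segSide (L (s₀ - η)) (L (s₀ + η)) ℓ < 0)
    (sr : 0 < segSide (L (s₀ - η)) (L (s₀ + η)) r) :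
    ℓ ∉ L '' Icc a b ∧ r ∉ L '' Icc a b ∧
      wind (fun τ => L (a + τ * (b - a)) - ℓ) - wind (fun τ => L (a + τ * (b - a)) - r) = 1 := by
  set u := s₀ - η with hu
  set u' := s₀ + η with hu'
  have huu' : u < u' := by rw [hu, hu']; linarith
  have hd2 : u' - u = 2 * η := by rw [hu, hu']; ring
  set A := L u with hA
  set B := L u' with hB
  have hx : ∃ p ∈ segment ℝ A B, p ∈ openSegment ℝ ℓ r :=
    exists_mem_segment_mem_openSegment sA sB sl sr
  have eA : ‖A - (c - (η : ℂ) * v)‖ ≤ θ * η := by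
    have h := hLlin u (by rw [hu, sub_sub_cancel_left, abs_neg, abs_of_pos hη0])
    rw [hu, sub_sub_cancel_left, abs_neg, abs_of_pos hη0, ofReal_neg] at h
    convert h using 2
    ring
  have eB : ‖B - (c + (η : ℂ) * v)‖ ≤ θ * η := by
    have h := hLlin u' (by rw [hu', add_sub_cancel_left, abs_of_pos hη0])
    rw [hu', add_sub_cancel_left, abs_of_pos hη0] at h
    exact h
  -- the segment `[ℓ, r]` is close to `c`
  have hnear : ∀ z ∈ segment ℝ ℓ r, ‖z - c‖ ≤ ε * (‖w‖ + 1) := by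
    intro z hz
    have hεw : ‖(ε : ℂ) * w‖ = ε * ‖w‖ := by
      rw [norm_mul, Complex.norm_real, Real.norm_eq_abs, abs_of_pos hε0]
    have hθε : θ * ε ≤ 1 * ε := mul_le_mul_of_nonneg_right hθ1 hε0.le
    refine norm_sub_le_of_mem_segment ?_ ?_ hz
    · have h := norm_sub_le_norm_sub_add_norm_sub ℓ (c - (ε : ℂ) * w) c
      rw [sub_sub_cancel_left, norm_neg, hεw] at h
      linarith
    · have h := norm_sub_le_norm_sub_add_norm_sub r (c + (ε : ℂ) * w) c
      rw [add_sub_cancel_left, hεw] at h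
      linarith
  -- the straightened loop
  set L' : ℝ → ℂ := fun s => if s ∈ Icc u u' then AffineMap.lineMap A B ((s - u) / (u' - u))
    else L s with hL'
  have hL'mid : ∀ s ∈ Icc u u', L' s = AffineMap.lineMap A B ((s - u) / (u' - u)) :=
    fun s hs => if_pos hs
  have hL'u : L' u = L u := by
    rw [hL'mid u (left_mem_Icc.2 huu'.le), sub_self, zero_div, AffineMap.lineMap_apply_zero]
  have hL'u' : L' u' = L u' := by
    rw [hL'mid u' (right_mem_Icc.2 huu'.le), div_self (sub_pos.2 huu').ne',
      AffineMap.lineMap_apply_one]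
  have hL'out : ∀ s, s ∉ Ioo u u' → L' s = L s := by
    intro s hs
    by_cases hs' : s ∈ Icc u u'
    · rcases hs'.1.eq_or_lt with h | h
      · rw [← h, hL'u]
      · rcases hs'.2.eq_or_lt with h' | h'
        · rw [h', hL'u']
        · exact absurd ⟨h, h'⟩ hs
    · exact if_neg hs'
  have hL'a : L' a = L a := hL'out a fun h => lt_irrefl _ (hau.trans h.1)
  have hL'b : L' b = L b := hL'out b fun h => lt_irrefl _ (h.2.trans hub)
  have hL'c : ContinuousOn L' (Icc a b) := by
    refine ContinuousOn.if ?_ ?_ (hL.mono inter_subset_left)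
    · rintro s ⟨-, hsfr⟩
      rw [setOf_mem_eq, frontier_Icc huu'.le] at hsfr
      rcases hsfr with rfl | rfl
      · rw [sub_self, zero_div, AffineMap.lineMap_apply_zero]
      · rw [div_self (sub_pos.2 huu').ne', AffineMap.lineMap_apply_one]
    · exact (AffineMap.lineMap_continuous.comp (by fun_prop)).continuousOn
  -- the chord is `θ η`-close to the tangent line
  have hchord : ∀ s ∈ Icc u u', ‖L' s - (c + ((s - s₀ : ℝ) : ℂ) * v)‖ ≤ θ * η := by
    intro s hs
    set lam : ℝ := (s - u) / (u' - u) with hlam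
    have hlam0 : 0 ≤ lam := div_nonneg (sub_nonneg.2 hs.1) (by linarith)
    have hlam1 : lam ≤ 1 := (div_le_one (by linarith)).2 (sub_le_sub_right hs.2 _)
    have hss₀ : ((s - s₀ : ℝ) : ℂ) = ((2 * lam - 1 : ℝ) : ℂ) * (η : ℂ) := by
      rw [← ofReal_mul]; congr 1; rw [hlam, hd2, hu]; field_simp; ring
    rw [hL'mid s hs, ← hlam, AffineMap.lineMap_apply_module]
    have e : (1 - lam) • A + lam • B - (c + ((s - s₀ : ℝ) : ℂ) * v) =
        ((1 - lam : ℝ) : ℂ) * (A - (c - (η : ℂ) * v)) + (lam : ℂ) * (B - (c + (η : ℂ) * v)) := by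
      rw [hss₀, Complex.real_smul, Complex.real_smul]; push_cast; ring
    rw [e]
    calc ‖((1 - lam : ℝ) : ℂ) * (A - (c - (η : ℂ) * v)) + (lam : ℂ) * (B - (c + (η : ℂ) * v))‖
        ≤ ‖((1 - lam : ℝ) : ℂ) * (A - (c - (η : ℂ) * v))‖
            + ‖(lam : ℂ) * (B - (c + (η : ℂ) * v))‖ := norm_add_le _ _
      _ = (1 - lam) * ‖A - (c - (η : ℂ) * v)‖ + lam * ‖B - (c + (η : ℂ) * v)‖ := by
          rw [norm_mul, norm_mul, Complex.norm_real, Complex.norm_real, Real.norm_eq_abs,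
            Real.norm_eq_abs, abs_of_nonneg (by linarith), abs_of_nonneg hlam0]
      _ ≤ (1 - lam) * (θ * η) + lam * (θ * η) :=
          add_le_add (mul_le_mul_of_nonneg_left eA (by linarith))
            (mul_le_mul_of_nonneg_left eB hlam0)
      _ = θ * η := by ring
  -- Rouché's inequality along `[a, b]`, for `p = ℓ` and `p = r`
  have hrouche : ∀ (p p₀ : ℂ) (σ : ℝ), |σ| = ε → p₀ = c + (σ : ℂ) * w → ‖p - p₀‖ ≤ θ * ε →
      p ∈ segment ℝ ℓ r → ∀ s ∈ Icc a b, ‖L' s - L s‖ < ‖L s - p‖ := by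
    intro p p₀ σ hσ hp₀ hp hpseg s hs
    by_cases hsI : s ∈ Ioo u u'
    · have hsabs : |s - s₀| < η := by
        rw [hu, hu'] at hsI
        rw [abs_lt]; constructor <;> linarith [hsI.1, hsI.2]
      have h1 := hchord s ⟨hsI.1.le, hsI.2.le⟩
      have h2 := hLlin s hsabs.le
      have h12 : ‖L' s - L s‖ ≤ 2 * θ * η := by
        have h := norm_sub_le_norm_sub_add_norm_sub (L' s) (c + ((s - s₀ : ℝ) : ℂ) * v) (L s)
        rw [norm_sub_rev (c + ((s - s₀ : ℝ) : ℂ) * v) (L s)] at h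
        have t3 : θ * |s - s₀| ≤ θ * η := mul_le_mul_of_nonneg_left hsabs.le hθ0
        linarith
      have h3 : ε * D / ‖v‖ - θ * η - θ * ε ≤ ‖L s - p‖ := by
        have hkey := hsep (s - s₀) (-σ) (by rw [abs_neg, hσ])
        have e1 : ((s - s₀ : ℝ) : ℂ) * v + ((-σ : ℝ) : ℂ) * w
            = (c + ((s - s₀ : ℝ) : ℂ) * v) - p₀ := by
          rw [hp₀]; push_cast; ring
        rw [e1] at hkey
        have hkey' : ε * D / ‖v‖ ≤ ‖c + ((s - s₀ : ℝ) : ℂ) * v - p₀‖ := by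
          rw [div_le_iff₀ hv]; exact hkey
        have t1 := norm_sub_le_norm_sub_add_norm_sub (c + ((s - s₀ : ℝ) : ℂ) * v) (L s) p₀
        have t2 := norm_sub_le_norm_sub_add_norm_sub (L s) p p₀
        rw [norm_sub_rev (c + ((s - s₀ : ℝ) : ℂ) * v) (L s)] at t1
        have t3 : θ * |s - s₀| ≤ θ * η := mul_le_mul_of_nonneg_left hsabs.le hθ0
        linarith
      linarith
    · rw [hL'out s hsI, sub_self, norm_zero, norm_pos_iff, sub_ne_zero]
      intro hLs
      have hsη : η ≤ |s - s₀| := by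
        rw [hu, hu'] at hsI
        rcases le_or_gt s (s₀ - η) with h | h
        · rw [abs_of_nonpos (by linarith)]; linarith
        · have h' : s₀ + η ≤ s := by
            by_contra h'
            exact hsI ⟨h, lt_of_not_ge h'⟩
          rw [abs_of_nonneg (by linarith)]; linarith
      have h1 := hLfar s hs hsη
      have h2 := hnear p hpseg
      rw [hLs] at h1
      linarith
  have hRℓ := hrouche ℓ (c - (ε : ℂ) * w) (-ε) (by rw [abs_neg, abs_of_pos hε0])
    (by push_cast; ring) eℓ (left_mem_segment _ _ _)
  have hRr := hrouche r (c + (ε : ℂ) * w) ε (abs_of_pos hε0) rfl er (right_mem_segment _ _ _)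
  -- the straightened loop avoids `[ℓ, r]` away from the chord
  have hout : ∀ s ∈ Icc a u ∪ Icc u' b, L' s ∉ segment ℝ ℓ r := by
    intro s hs hseg
    have hsab : s ∈ Icc a b := by
      rcases hs with hs | hs
      · exact ⟨hs.1, hs.2.trans (huu'.le.trans hub.le)⟩
      · exact ⟨(hau.le.trans huu'.le).trans hs.1, hs.2⟩
    have hsI : s ∉ Ioo u u' := by
      rintro ⟨h1, h2⟩
      rcases hs with hs | hs
      · linarith [hs.2]
      · linarith [hs.1]
    have hsη : η ≤ |s - s₀| := by
      rcases hs with hs | hs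
      · have h2 : s ≤ s₀ - η := hu ▸ hs.2
        rw [abs_of_nonpos (by linarith)]; linarith
      · have h2 : s₀ + η ≤ s := hu' ▸ hs.1
        rw [abs_of_nonneg (by linarith)]; linarith
    have h1 := hLfar s hsab hsη
    have h2 := hnear _ hseg
    rw [hL'out s hsI] at h2
    linarith
  -- conclusion
  have hjump := wind_sub_wind_of_straight_cross hau.le huu' hub.le hL'c
    (by rw [hL'a, hL'b, hab]) (fun s hs => by rw [hL'mid s hs, hL'u, hL'u']) hout
    (by rw [hL'u]; exact sA) (by rw [hL'u']; exact sB) (by rw [hL'u, hL'u']; exact hx)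
  have hab' : a ≤ b := hau.le.trans (huu'.le.trans hub.le)
  rw [wind_affine_sub_eq_of_norm_sub_lt hab' hL hL'c hab (by rw [hL'a, hL'b, hab]) hRℓ,
    wind_affine_sub_eq_of_norm_sub_lt hab' hL hL'c hab (by rw [hL'a, hL'b, hab]) hRr] at hjump
  refine ⟨?_, ?_, hjump⟩
  · rintro ⟨s, hs, hLs⟩
    have := hRℓ s hs
    rw [hLs, sub_self, norm_zero] at this
    exact (norm_nonneg _).not_gt this
  · rintro ⟨s, hs, hLs⟩
    have := hRr s hs
    rw [hLs, sub_self, norm_zero] at this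
    exact (norm_nonneg _).not_gt this

/-- **The winding number jumps by one across a transversal crossing.** Let `L` be a loop on
`[a, b]` (`L a = L b`), differentiable at the interior parameter `s₀` with velocity `v`, passing
through `c = L s₀` at no other parameter of `[a, b]`; let `R` be differentiable at `t₀` with
`R t₀ = c` and velocity `w`, and suppose `Im (v conj w) > 0` (the crossing is transversal, `R`
crosses `L` from its right to its left). Then for all sufficiently small `ε > 0` the points
`R (t₀ ∓ ε)` lie off the loop and `wind (L - R (t₀ - ε)) - wind (L - R (t₀ + ε)) = 1`.
Proof: replace `L` on `[s₀ - Mε, s₀ + Mε]` by its chord (`M` large against `‖w‖/‖v‖`); by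
differentiability the chord is uniformly `o(ε)`-close to `L` there while `R (t₀ ∓ ε)` stay at
distance `≳ ε` from `L`, so neither winding number changes (Rouché); the straightened loop is
handled by `wind_sub_wind_of_straight_cross` (`wind_sub_wind_of_chord_estimates`). Ahlfors
(1979), §4.2.1, Lemma 2. [folklore] -/
theorem wind_sub_wind_of_hasDerivAt_cross {L R : ℝ → ℂ} {a b s₀ t₀ : ℝ} {v w : ℂ}
    (hL : ContinuousOn L (Icc a b)) (hab : L a = L b) (hs₀ : s₀ ∈ Ioo a b)
    (hd : HasDerivAt L v s₀) (hinj : ∀ s ∈ Icc a b, L s = L s₀ → s = s₀)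
    (hR : HasDerivAt R w t₀) (hRc : R t₀ = L s₀) (hD : 0 < (v * conj w).im) :
    ∀ᶠ ε in 𝓝[>] (0 : ℝ), R (t₀ - ε) ∉ L '' Icc a b ∧ R (t₀ + ε) ∉ L '' Icc a b ∧
      wind (fun τ => L (a + τ * (b - a)) - R (t₀ - ε)) -
        wind (fun τ => L (a + τ * (b - a)) - R (t₀ + ε)) = 1 := by
  set c := L s₀ with hc
  set D := (v * conj w).im with hDdef
  have hDeq : D = v.im * w.re - v.re * w.im := by
    rw [hDdef]; simp only [mul_im, conj_re, conj_im]; ring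
  have hv0 : v ≠ 0 := by rintro rfl; simp [hDdef] at hD
  have hw0 : w ≠ 0 := by rintro rfl; simp [hDdef] at hD
  have hv : 0 < ‖v‖ := norm_pos_iff.2 hv0
  -- scales: chord half-width `M ε`, accuracy `θ`
  set M : ℝ := 4 * (‖w‖ + 1) / ‖v‖ + 1 with hM
  have hM1 : 1 ≤ M := by
    have : 0 ≤ 4 * (‖w‖ + 1) / ‖v‖ := by positivity
    linarith
  have hM0 : 0 < M := by linarith
  have hMv : 4 * (‖w‖ + 1) ≤ M * ‖v‖ := by
    rw [hM, add_mul, div_mul_cancel₀ _ hv.ne', one_mul]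
    linarith
  set θ : ℝ := min (min 1 (‖v‖ / 2)) (D / (2 * ‖v‖ * (3 * M + 1))) with hθ
  have hθ0 : 0 < θ := lt_min (lt_min one_pos (half_pos hv)) (div_pos hD (by positivity))
  have hθ1 : θ ≤ 1 := (min_le_left _ _).trans (min_le_left _ _)
  have hθv : θ ≤ ‖v‖ / 2 := (min_le_left _ _).trans (min_le_right _ _)
  have hθD : θ * (2 * ‖v‖ * (3 * M + 1)) ≤ D := by
    have h := min_le_right (min 1 (‖v‖ / 2)) (D / (2 * ‖v‖ * (3 * M + 1)))
    rwa [← hθ, le_div_iff₀ (by positivity)] at h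
  -- derivative estimates and the far zone
  obtain ⟨δL, hδL, hLest⟩ := exists_forall_norm_sub_sub_mul_le hd hθ0
  obtain ⟨δR, hδR, hRest⟩ := exists_forall_norm_sub_sub_mul_le hR hθ0
  obtain ⟨ρ₀, hρ₀, hfar⟩ := exists_pos_forall_le_norm_sub (s₀ := s₀) hL hinj (half_pos hδL)
  -- slopes, for the sign conditions
  have Tl : Tendsto (fun ε : ℝ => ε⁻¹ • (R (t₀ - ε) - c)) (𝓝[>] 0) (𝓝 (-w)) := by
    have h := tendsto_slope_comp_mul hR (m := -1) (by norm_num)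
    rw [neg_one_smul] at h
    refine h.congr fun ε => ?_
    rw [hRc, neg_one_mul, ← sub_eq_add_neg]
  have Tr : Tendsto (fun ε : ℝ => ε⁻¹ • (R (t₀ + ε) - c)) (𝓝[>] 0) (𝓝 w) := by
    have h := tendsto_slope_comp_mul hR (m := 1) one_ne_zero
    rw [one_smul] at h
    refine h.congr fun ε => ?_
    rw [hRc, one_mul]
  have TA : Tendsto (fun ε : ℝ => ε⁻¹ • (L (s₀ - M * ε) - c)) (𝓝[>] 0)
      (𝓝 (-((M : ℂ) * v))) := by
    have h := tendsto_slope_comp_mul hd (m := -M) (neg_ne_zero.2 hM0.ne')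
    rw [Complex.real_smul, ofReal_neg, neg_mul] at h
    refine h.congr fun ε => ?_
    rw [neg_mul, ← sub_eq_add_neg]
  have TB : Tendsto (fun ε : ℝ => ε⁻¹ • (L (s₀ + M * ε) - c)) (𝓝[>] 0) (𝓝 ((M : ℂ) * v)) := by
    have h := tendsto_slope_comp_mul hd (m := M) hM0.ne'
    rwa [Complex.real_smul] at h
  -- the four limiting side values
  have SA : 0 < segSide (-w) w (-((M : ℂ) * v)) := by
    have e : segSide (-w) w (-((M : ℂ) * v)) = 2 * M * D := by
      rw [segSide_eq, hDeq]
      simp only [sub_neg_eq_add, neg_re, neg_im, add_re, add_im, sub_re, sub_im, mul_re, mul_im,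
        ofReal_re, ofReal_im, zero_mul, sub_zero, add_zero]
      ring
    rw [e]; positivity
  have SB : segSide (-w) w ((M : ℂ) * v) < 0 := by
    have e : segSide (-w) w ((M : ℂ) * v) = -(2 * M * D) := by
      rw [segSide_eq, hDeq]
      simp only [sub_neg_eq_add, add_re, add_im, sub_re, sub_im, mul_re, mul_im,
        ofReal_re, ofReal_im, zero_mul, sub_zero, add_zero]
      ring
    rw [e, neg_lt_zero]; positivity
  have Sl : segSide (-((M : ℂ) * v)) ((M : ℂ) * v) (-w) < 0 := by
    have e : segSide (-((M : ℂ) * v)) ((M : ℂ) * v) (-w) = -(2 * M * D) := by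
      rw [segSide_eq, hDeq]
      simp only [sub_neg_eq_add, neg_re, neg_im, add_re, add_im, sub_re, sub_im, mul_re, mul_im,
        ofReal_re, ofReal_im, zero_mul, sub_zero, add_zero]
      ring
    rw [e, neg_lt_zero]; positivity
  have Sr : 0 < segSide (-((M : ℂ) * v)) ((M : ℂ) * v) w := by
    have e : segSide (-((M : ℂ) * v)) ((M : ℂ) * v) w = 2 * M * D := by
      rw [segSide_eq, hDeq]
      simp only [add_re, add_im, sub_re, sub_im, mul_re, mul_im, sub_neg_eq_add,
        ofReal_re, ofReal_im, zero_mul, sub_zero, add_zero]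
      ring
    rw [e]; positivity
  have hcont := continuous_segSide₃
  -- eventual conditions on `ε`
  have E0 : ∀ᶠ ε in 𝓝[>] (0 : ℝ), 0 < ε := eventually_mem_nhdsWithin
  have E1 : ∀ᶠ ε in 𝓝[>] (0 : ℝ), M * ε < δL / 2 := eventually_mul_lt_nhdsGT (half_pos hδL)
  have E2 : ∀ᶠ ε in 𝓝[>] (0 : ℝ), 1 * ε < δR := eventually_mul_lt_nhdsGT hδR
  have E3 : ∀ᶠ ε in 𝓝[>] (0 : ℝ), (‖w‖ + 1) * ε < ρ₀ := eventually_mul_lt_nhdsGT hρ₀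
  have E4 : ∀ᶠ ε in 𝓝[>] (0 : ℝ), M * ε < min (s₀ - a) (b - s₀) :=
    eventually_mul_lt_nhdsGT (lt_min (sub_pos.2 hs₀.1) (sub_pos.2 hs₀.2))
  have E5 : ∀ᶠ ε in 𝓝[>] (0 : ℝ), 0 < segSide (ε⁻¹ • (R (t₀ - ε) - c)) (ε⁻¹ • (R (t₀ + ε) - c))
      (ε⁻¹ • (L (s₀ - M * ε) - c)) :=
    ((hcont.tendsto _).comp (Tl.prodMk_nhds (Tr.prodMk_nhds TA))).eventually
      (eventually_gt_nhds SA)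
  have E6 : ∀ᶠ ε in 𝓝[>] (0 : ℝ), segSide (ε⁻¹ • (R (t₀ - ε) - c)) (ε⁻¹ • (R (t₀ + ε) - c))
      (ε⁻¹ • (L (s₀ + M * ε) - c)) < 0 :=
    ((hcont.tendsto _).comp (Tl.prodMk_nhds (Tr.prodMk_nhds TB))).eventually
      (eventually_lt_nhds SB)
  have E7 : ∀ᶠ ε in 𝓝[>] (0 : ℝ), segSide (ε⁻¹ • (L (s₀ - M * ε) - c))
      (ε⁻¹ • (L (s₀ + M * ε) - c)) (ε⁻¹ • (R (t₀ - ε) - c)) < 0 :=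
    ((hcont.tendsto _).comp (TA.prodMk_nhds (TB.prodMk_nhds Tl))).eventually
      (eventually_lt_nhds Sl)
  have E8 : ∀ᶠ ε in 𝓝[>] (0 : ℝ), 0 < segSide (ε⁻¹ • (L (s₀ - M * ε) - c))
      (ε⁻¹ • (L (s₀ + M * ε) - c)) (ε⁻¹ • (R (t₀ + ε) - c)) :=
    ((hcont.tendsto _).comp (TA.prodMk_nhds (TB.prodMk_nhds Tr))).eventually
      (eventually_gt_nhds Sr)
  filter_upwards [E0, E1, E2, E3, E4, E5, E6, E7, E8] with ε hε0 hε1 hε2 hε3 hε4 hε5 hε6 hε7 hε8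
  rw [one_mul] at hε2
  -- a fixed small `ε` from now on
  have hη0 : 0 < M * ε := mul_pos hM0 hε0
  have hηδ : M * ε < δL := by linarith
  have hau : a < s₀ - M * ε := by have := (lt_min_iff.1 hε4).1; linarith
  have hub : s₀ + M * ε < b := by have := (lt_min_iff.1 hε4).2; linarith
  -- recovering the points from the rescaled ones: the sign conditions
  have hback : ∀ z : ℂ, c + ε • (ε⁻¹ • (z - c)) = z := fun z => by
    rw [smul_smul, mul_inv_cancel₀ hε0.ne', one_smul, add_sub_cancel]
  have hsq : 0 < ε ^ 2 := by positivity
  have hsign : ∀ p q z : ℂ, segSide p q z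
      = ε ^ 2 * segSide (ε⁻¹ • (p - c)) (ε⁻¹ • (q - c)) (ε⁻¹ • (z - c)) := by
    intro p q z
    have e := segSide_translate_smul c (ε⁻¹ • (p - c)) (ε⁻¹ • (q - c)) (ε⁻¹ • (z - c)) ε
    rwa [hback, hback, hback] at e
  have sA : 0 < segSide (R (t₀ - ε)) (R (t₀ + ε)) (L (s₀ - M * ε)) := by
    rw [hsign]; exact mul_pos hsq hε5
  have sB : segSide (R (t₀ - ε)) (R (t₀ + ε)) (L (s₀ + M * ε)) < 0 := by
    rw [hsign]; exact mul_neg_of_pos_of_neg hsq hε6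
  have sl : segSide (L (s₀ - M * ε)) (L (s₀ + M * ε)) (R (t₀ - ε)) < 0 := by
    rw [hsign]; exact mul_neg_of_pos_of_neg hsq hε7
  have sr : 0 < segSide (L (s₀ - M * ε)) (L (s₀ + M * ε)) (R (t₀ + ε)) := by
    rw [hsign]; exact mul_pos hsq hε8
  -- point estimates
  have eℓ : ‖R (t₀ - ε) - (c - (ε : ℂ) * w)‖ ≤ θ * ε := by
    have h := hRest (t₀ - ε) (by
      rw [sub_sub_cancel_left, abs_neg, abs_of_pos hε0]; exact hε2)
    rw [hRc, sub_sub_cancel_left, abs_neg, abs_of_pos hε0, ofReal_neg] at h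
    convert h using 2
    ring
  have er : ‖R (t₀ + ε) - (c + (ε : ℂ) * w)‖ ≤ θ * ε := by
    have h := hRest (t₀ + ε) (by rw [add_sub_cancel_left, abs_of_pos hε0]; exact hε2)
    rw [hRc, add_sub_cancel_left, abs_of_pos hε0] at h
    convert h using 2
    ring
  have hLlin : ∀ s, |s - s₀| ≤ M * ε →
      ‖L s - (c + ((s - s₀ : ℝ) : ℂ) * v)‖ ≤ θ * |s - s₀| := by
    intro s hs
    have h := hLest s (lt_of_le_of_lt hs hηδ)
    convert h using 2
    ring
  -- far points of `L` are farther from `c` than the segment `[ℓ, r]`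
  have hLfar : ∀ s ∈ Icc a b, M * ε ≤ |s - s₀| → ε * (‖w‖ + 1) < ‖L s - c‖ := by
    intro s hs hsη
    rcases lt_or_ge |s - s₀| δL with h1 | h1
    · -- intermediate zone: the linear term dominates
      have hlin := hLest s h1
      have hmain : ‖((s - s₀ : ℝ) : ℂ) * v‖ = |s - s₀| * ‖v‖ := by
        rw [norm_mul, Complex.norm_real, Real.norm_eq_abs]
      have hge : |s - s₀| * ‖v‖ - θ * |s - s₀| ≤ ‖L s - c‖ := by
        have h2 := norm_sub_le_norm_sub_add_norm_sub (((s - s₀ : ℝ) : ℂ) * v) (L s - c) 0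
        have h3 : ‖((s - s₀ : ℝ) : ℂ) * v - (L s - c)‖ = ‖L s - L s₀ - ((s - s₀ : ℝ) : ℂ) * v‖ := by
          rw [← norm_neg]; congr 1; rw [hc]; ring
        rw [sub_zero, sub_zero, hmain, h3] at h2
        linarith
      have h4 : θ * |s - s₀| ≤ ‖v‖ / 2 * |s - s₀| :=
        mul_le_mul_of_nonneg_right hθv (abs_nonneg _)
      have h5 : M * ε * ‖v‖ ≤ |s - s₀| * ‖v‖ := mul_le_mul_of_nonneg_right hsη hv.le
      have h6 : ε * (4 * (‖w‖ + 1)) ≤ ε * (M * ‖v‖) := mul_le_mul_of_nonneg_left hMv hε0.le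
      have h7 : 0 < ε * (‖w‖ + 1) := by positivity
      nlinarith
    · -- far zone
      have h2 := hfar s hs (by linarith)
      linarith
  -- transversal separation and the gap
  have hsep : ∀ (x σ : ℝ), |σ| = ε → ε * D ≤ ‖(x : ℂ) * v + (σ : ℂ) * w‖ * ‖v‖ := by
    intro x σ hσ
    have h := abs_mul_abs_im_le_norm_add_smul v w x σ
    rw [hσ, ← hDdef, abs_of_pos hD, Complex.real_smul, Complex.real_smul] at h
    exact h
  have hgap : 2 * θ * (M * ε) + θ * (M * ε) + θ * ε < ε * D / ‖v‖ := by
    rw [lt_div_iff₀ hv]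
    have e2 : (2 * θ * (M * ε) + θ * (M * ε) + θ * ε) * ‖v‖
        = ε * (θ * (2 * ‖v‖ * (3 * M + 1))) / 2 := by ring
    rw [e2]
    have h5 : ε * (θ * (2 * ‖v‖ * (3 * M + 1))) / 2 ≤ ε * D / 2 := by gcongr
    have h6 : 0 < ε * D := mul_pos hε0 hD
    linarith
  exact wind_sub_wind_of_chord_estimates hL hab hη0 hε0 hθ0.le hθ1 hau hub hv hLlin
    hLfar eℓ er hsep hgap sA sB sl sr

/-- The version of `wind_sub_wind_of_hasDerivAt_cross` for either orientation of the crossing: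
if `Im (v conj w) ≠ 0` then for all small `ε > 0` the points `R (t₀ ∓ ε)` are off the loop and
`wind (L - R (t₀ + ε)) - wind (L - R (t₀ - ε)) = ±1`. (For `Im (v conj w) < 0` apply the
previous statement to the reversed path `t ↦ R (2 t₀ - t)`.) [folklore] -/
theorem wind_sub_wind_of_hasDerivAt_cross' {L R : ℝ → ℂ} {a b s₀ t₀ : ℝ} {v w : ℂ}
    (hL : ContinuousOn L (Icc a b)) (hab : L a = L b) (hs₀ : s₀ ∈ Ioo a b)
    (hd : HasDerivAt L v s₀) (hinj : ∀ s ∈ Icc a b, L s = L s₀ → s = s₀)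
    (hR : HasDerivAt R w t₀) (hRc : R t₀ = L s₀) (hD : (v * conj w).im ≠ 0) :
    ∀ᶠ ε in 𝓝[>] (0 : ℝ), R (t₀ - ε) ∉ L '' Icc a b ∧ R (t₀ + ε) ∉ L '' Icc a b ∧
      (wind (fun τ => L (a + τ * (b - a)) - R (t₀ + ε)) -
          wind (fun τ => L (a + τ * (b - a)) - R (t₀ - ε)) = 1 ∨
        wind (fun τ => L (a + τ * (b - a)) - R (t₀ + ε)) -
          wind (fun τ => L (a + τ * (b - a)) - R (t₀ - ε)) = -1) := by
  rcases hD.lt_or_gt with hD | hD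
  · -- `Im (v conj w) < 0`: reverse `R`
    set R' : ℝ → ℂ := fun t => R (2 * t₀ - t) with hR'
    have hR'd : HasDerivAt R' (-w) t₀ := by
      have hg : HasDerivAt (fun t : ℝ => 2 * t₀ - t) (-1) t₀ := (hasDerivAt_id t₀).const_sub _
      have h := HasDerivAt.scomp (g₁ := R) (h := fun t : ℝ => 2 * t₀ - t) t₀
        (by rw [show 2 * t₀ - t₀ = t₀ by ring]; exact hR) hg
      rwa [neg_one_smul] at h
    have hD' : 0 < (v * conj (-w)).im := by
      rw [map_neg, mul_neg, neg_im]; linarith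
    have h := wind_sub_wind_of_hasDerivAt_cross hL hab hs₀ hd hinj hR'd
      (by rw [hR']; simp only; rw [show 2 * t₀ - t₀ = t₀ by ring, hRc]) hD'
    filter_upwards [h] with ε hε
    have e1 : R' (t₀ - ε) = R (t₀ + ε) := by rw [hR']; simp only; congr 1; ring
    have e2 : R' (t₀ + ε) = R (t₀ - ε) := by rw [hR']; simp only; congr 1; ring
    rw [e1, e2] at hε
    exact ⟨hε.2.1, hε.1, Or.inl hε.2.2⟩
  · have h := wind_sub_wind_of_hasDerivAt_cross hL hab hs₀ hd hinj hR hRc hD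
    filter_upwards [h] with ε hε
    exact ⟨hε.1, hε.2.1, Or.inr (by linarith [hε.2.2])⟩

/-! ### The corner of a loop at a transversal double point -/

/-- Far from both ends, a loop that closes up only at its ends stays away from its base point.
[folklore] -/
theorem exists_pos_forall_le_norm_sub_ends {γ : ℝ → ℂ} {a b δ₁ δ₂ : ℝ}
    (hγ : ContinuousOn γ (Icc a b)) (hinj : ∀ s ∈ Icc a b, γ s = γ a → s = a ∨ s = b)
    (hδ₁ : 0 < δ₁) (hδ₂ : 0 < δ₂) :
    ∃ ρ > 0, ∀ s ∈ Icc a b, δ₁ ≤ s - a → δ₂ ≤ b - s → ρ ≤ ‖γ s - γ a‖ := by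
  set T : Set ℝ := Icc a b ∩ ({s | δ₁ ≤ s - a} ∩ {s | δ₂ ≤ b - s}) with hT
  have hTc : IsCompact T :=
    isCompact_Icc.inter_right ((isClosed_le continuous_const (by fun_prop)).inter
      (isClosed_le continuous_const (by fun_prop)))
  rcases T.eq_empty_or_nonempty with hTe | hTne
  · refine ⟨1, one_pos, fun s hs h1 h2 => ?_⟩
    have h : s ∈ T := ⟨hs, h1, h2⟩
    rw [hTe] at h
    exact h.elim
  · have hc : ContinuousOn (fun s => ‖γ s - γ a‖) T :=
      ((hγ.mono inter_subset_left).sub continuousOn_const).norm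
    obtain ⟨s₁, hs₁, hmin⟩ := hTc.exists_isMinOn hTne hc
    have hpos : 0 < ‖γ s₁ - γ a‖ := by
      rw [norm_pos_iff, sub_ne_zero]
      intro h
      have h2 := hs₁.2
      simp only [mem_inter_iff, mem_setOf_eq] at h2
      rcases hinj s₁ hs₁.1 h with h1 | h1 <;> rw [h1] at h2
      · simp only [sub_self] at h2; linarith [h2.1]
      · simp only [sub_self] at h2; linarith [h2.2]
    exact ⟨_, hpos, fun s hs h1 h2 => (isMinOn_iff.1 hmin) s ⟨hs, h1, h2⟩⟩

/-- **Corner step, for a fixed scale.** Let the loop `γ` on `[a, b]` close up at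
`x = γ a = γ b` with the following estimates (accuracy `θ`): `γ` is `θ`-close to the ray
`x + (s - a) v₁` for `|s - a| ≤ M ε` and to `x + (s - b) v₂` for `|s - b| ≤ M ε`, the points
`γ s` with `s - a, b - s ≥ M ε` are farther than `ε (‖v₁‖ + ‖v₂‖ + 1)` from `x`, and
`θ (1 + M) (‖v₁‖ + ‖v₂‖) < |Im (v₁ conj v₂)|`. Then the segment from `γ (b + ε)` to
`γ (a - ε)` misses `γ [a, b]`: in the oblique coordinates `(v₁, v₂)` at `x` the segment lies in
the closed quadrant `{α ≤ 0, β ≥ 0}` at distance `≍ ε` from `x`, while the two branches of the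
loop at `x` leave along `α ≥ 0, β = 0` and arrive along `α = 0, β ≤ 0`. [folklore] -/
theorem segment_disjoint_of_corner_estimates {γ : ℝ → ℂ} {a b ε M θ : ℝ} {v₁ v₂ x : ℂ}
    (hε0 : 0 < ε) (hM1 : 1 ≤ M) (hθ0 : 0 ≤ θ) (hθ1 : θ ≤ 1)
    (h1lin : ∀ s, |s - a| ≤ M * ε → ‖γ s - (x + ((s - a : ℝ) : ℂ) * v₁)‖ ≤ θ * |s - a|)
    (h2lin : ∀ s, |s - b| ≤ M * ε → ‖γ s - (x + ((s - b : ℝ) : ℂ) * v₂)‖ ≤ θ * |s - b|)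
    (hfar : ∀ s ∈ Icc a b, M * ε ≤ s - a → M * ε ≤ b - s →
      ε * (‖v₁‖ + ‖v₂‖ + 1) < ‖γ s - x‖)
    (hθD : θ * (1 + M) * (‖v₁‖ + ‖v₂‖) < |(v₁ * conj v₂).im|) :
    ∀ z ∈ segment ℝ (γ (b + ε)) (γ (a - ε)), z ∉ γ '' Icc a b := by
  set D := (v₁ * conj v₂).im with hD
  have hMε : 0 < M * ε := by positivity
  have hεM : ε ≤ M * ε := by nlinarith
  -- the two endpoints
  have e₁ : ‖γ (b + ε) - (x + (ε : ℂ) * v₂)‖ ≤ θ * ε := by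
    have h := h2lin (b + ε) (by rw [add_sub_cancel_left, abs_of_pos hε0]; exact hεM)
    rwa [add_sub_cancel_left, abs_of_pos hε0] at h
  have e₂ : ‖γ (a - ε) - (x - (ε : ℂ) * v₁)‖ ≤ θ * ε := by
    have h := h1lin (a - ε) (by rw [sub_sub_cancel_left, abs_neg, abs_of_pos hε0]; exact hεM)
    rw [sub_sub_cancel_left, abs_neg, abs_of_pos hε0, ofReal_neg] at h
    convert h using 2; ring
  rintro z hz ⟨s, hs, hsz⟩
  rw [segment_eq_image_lineMap] at hz
  obtain ⟨lam, ⟨hlam0, hlam1⟩, rfl⟩ := hz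
  rw [AffineMap.lineMap_apply_module] at hsz
  -- the point of the segment in the form `x + ε ((1 - λ) v₂ - λ v₁) + e`, `‖e‖ ≤ θ ε`
  set e : ℂ := ((1 - lam : ℝ) : ℂ) * (γ (b + ε) - (x + (ε : ℂ) * v₂))
    + (lam : ℂ) * (γ (a - ε) - (x - (ε : ℂ) * v₁)) with he
  have hz : (1 - lam) • γ (b + ε) + lam • γ (a - ε)
      = x + (((ε * (1 - lam) : ℝ) : ℂ) * v₂ - ((ε * lam : ℝ) : ℂ) * v₁) + e := by
    rw [he, Complex.real_smul, Complex.real_smul]; push_cast; ring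
  have he_le : ‖e‖ ≤ θ * ε := by
    rw [he]
    refine (norm_add_le _ _).trans ?_
    rw [norm_mul, norm_mul, Complex.norm_real, Complex.norm_real, Real.norm_eq_abs,
      Real.norm_eq_abs, abs_of_nonneg (by linarith), abs_of_nonneg hlam0]
    have t1 := mul_le_mul_of_nonneg_left e₁ (by linarith : (0 : ℝ) ≤ 1 - lam)
    have t2 := mul_le_mul_of_nonneg_left e₂ hlam0
    nlinarith
  rw [hz] at hsz
  -- `‖z - x‖ ≤ ε (‖v₁‖ + ‖v₂‖ + 1)`
  have hzx : ‖γ s - x‖ ≤ ε * (‖v₁‖ + ‖v₂‖ + 1) := by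
    rw [hsz, add_assoc, add_sub_cancel_left]
    refine (norm_add_le _ _).trans ?_
    have t1 : ‖((ε * (1 - lam) : ℝ) : ℂ) * v₂ - ((ε * lam : ℝ) : ℂ) * v₁‖
        ≤ ε * (1 - lam) * ‖v₂‖ + ε * lam * ‖v₁‖ := by
      refine (norm_sub_le _ _).trans ?_
      rw [norm_mul, norm_mul, Complex.norm_real, Complex.norm_real, Real.norm_eq_abs,
        Real.norm_eq_abs, abs_of_nonneg (by positivity), abs_of_nonneg (by positivity)]
    have t2 : ε * (1 - lam) * ‖v₂‖ ≤ ε * ‖v₂‖ := by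
      have := mul_le_mul_of_nonneg_right (mul_le_of_le_one_right hε0.le (by linarith) :
        ε * (1 - lam) ≤ ε) (norm_nonneg v₂)
      exact this
    have t3 : ε * lam * ‖v₁‖ ≤ ε * ‖v₁‖ :=
      mul_le_mul_of_nonneg_right (mul_le_of_le_one_right hε0.le hlam1) (norm_nonneg v₁)
    have t4 : θ * ε ≤ 1 * ε := mul_le_mul_of_nonneg_right hθ1 hε0.le
    linarith
  -- the algebraic contradiction near the two ends
  have key : ∀ (α β : ℝ) (E : ℂ), (α : ℂ) * v₁ + (β : ℂ) * v₂ = E →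
      ‖E‖ ≤ θ * (1 + M) * ε → ε * lam ≤ |α| → ε * (1 - lam) ≤ |β| → False := by
    intro α β E hE hEle hα hβ
    have i1 := abs_mul_abs_im_le_norm_add_smul v₁ v₂ α β
    have i2 := abs_mul_abs_im_le_norm_add_smul v₂ v₁ β α
    rw [Complex.real_smul, Complex.real_smul, hE, ← hD] at i1
    rw [Complex.real_smul, Complex.real_smul, add_comm, hE, im_mul_conj_swap v₁ v₂, ← hD,
      abs_neg] at i2
    have hDpos : 0 < |D| := lt_of_le_of_lt (by positivity) hθD
    have j1 : ε * (1 - lam) * |D| ≤ θ * (1 + M) * ε * ‖v₁‖ := by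
      calc ε * (1 - lam) * |D| ≤ |β| * |D| := mul_le_mul_of_nonneg_right hβ (abs_nonneg _)
        _ ≤ ‖E‖ * ‖v₁‖ := i1
        _ ≤ θ * (1 + M) * ε * ‖v₁‖ := mul_le_mul_of_nonneg_right hEle (norm_nonneg _)
    have j2 : ε * lam * |D| ≤ θ * (1 + M) * ε * ‖v₂‖ := by
      calc ε * lam * |D| ≤ |α| * |D| := mul_le_mul_of_nonneg_right hα (abs_nonneg _)
        _ ≤ ‖E‖ * ‖v₂‖ := i2
        _ ≤ θ * (1 + M) * ε * ‖v₂‖ := mul_le_mul_of_nonneg_right hEle (norm_nonneg _)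
    have j3 : ε * |D| ≤ ε * (θ * (1 + M) * (‖v₁‖ + ‖v₂‖)) := by nlinarith
    have j4 : |D| ≤ θ * (1 + M) * (‖v₁‖ + ‖v₂‖) := le_of_mul_le_mul_left j3 hε0
    linarith
  rcases le_or_gt (s - a) (M * ε) with hsa | hsa
  · -- near `a`: `γ s ≈ x + (s - a) v₁`
    have hs' : |s - a| ≤ M * ε := by rw [abs_of_nonneg (sub_nonneg.2 hs.1)]; exact hsa
    have hl := h1lin s hs'
    refine key (s - a + ε * lam) (-(ε * (1 - lam)))
      ((x + ((s - a : ℝ) : ℂ) * v₁ - γ s) + e) ?_ ?_ ?_ ?_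
    · rw [hsz]; push_cast; ring
    · refine (norm_add_le _ _).trans ?_
      rw [norm_sub_rev]
      have : θ * |s - a| ≤ θ * (M * ε) := mul_le_mul_of_nonneg_left hs' hθ0
      linarith
    · rw [abs_of_nonneg (by nlinarith [sub_nonneg.2 hs.1])]; nlinarith [sub_nonneg.2 hs.1]
    · rw [abs_neg, abs_of_nonneg (by nlinarith)]
  rcases le_or_gt (b - s) (M * ε) with hsb | hsb
  · -- near `b`: `γ s ≈ x + (s - b) v₂`
    have hs' : |s - b| ≤ M * ε := by
      rw [abs_of_nonpos (sub_nonpos.2 hs.2), neg_sub]; exact hsb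
    have hl := h2lin s hs'
    refine key (ε * lam) (s - b - ε * (1 - lam))
      ((x + ((s - b : ℝ) : ℂ) * v₂ - γ s) + e) ?_ ?_ ?_ ?_
    · rw [hsz]; push_cast; ring
    · refine (norm_add_le _ _).trans ?_
      rw [norm_sub_rev]
      have : θ * |s - b| ≤ θ * (M * ε) := mul_le_mul_of_nonneg_left hs' hθ0
      linarith
    · rw [abs_of_nonneg (by positivity)]
    · rw [abs_of_nonpos (by nlinarith [sub_nonpos.2 hs.2]), neg_sub]
      nlinarith [sub_nonpos.2 hs.2]
  · -- far from both ends
    have h := hfar s hs hsa.le hsb.le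
    linarith

/-- **At a transversal double point the two off-loop branches lie on the same side.** Let `γ`
restricted to `[a, b]` be a loop (`γ a = γ b = x`) closing up only at its ends, differentiable
at `a` and at `b` (as a map on `ℝ`) with independent velocities `v₁`, `v₂`. Then for all small
`ε > 0` the points `γ (b + ε)` (just after leaving the loop) and `γ (a - ε)` (just before entering
it) are off the loop and the loop has the same winding number about both: the segment joining
them misses the loop (`segment_disjoint_of_corner_estimates`, `wind_affine_sub_eq_of_segment`).
This is the local picture at a crossing of a normal closed curve: the lobe between the two visits
of the crossing does not separate the two outer branches. [folklore] -/
theorem wind_sub_eq_of_corner {γ : ℝ → ℂ} {a b : ℝ} {v₁ v₂ : ℂ} (hab : a < b)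
    (hγ : ContinuousOn γ (Icc a b)) (hloop : γ a = γ b)
    (h₁ : HasDerivAt γ v₁ a) (h₂ : HasDerivAt γ v₂ b) (hD : (v₁ * conj v₂).im ≠ 0)
    (hinj : ∀ s ∈ Icc a b, γ s = γ a → s = a ∨ s = b) :
    ∀ᶠ ε in 𝓝[>] (0 : ℝ), γ (b + ε) ∉ γ '' Icc a b ∧ γ (a - ε) ∉ γ '' Icc a b ∧
      wind (fun τ => γ (a + τ * (b - a)) - γ (b + ε)) =
        wind (fun τ => γ (a + τ * (b - a)) - γ (a - ε)) := by
  set x := γ a with hx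
  set D := (v₁ * conj v₂).im with hDdef
  have hv₁0 : v₁ ≠ 0 := by rintro rfl; simp [hDdef] at hD
  have hv₂0 : v₂ ≠ 0 := by rintro rfl; simp [hDdef] at hD
  have hv₁ : 0 < ‖v₁‖ := norm_pos_iff.2 hv₁0
  have hv₂ : 0 < ‖v₂‖ := norm_pos_iff.2 hv₂0
  have hDpos : 0 < |D| := abs_pos.2 hD
  set V : ℝ := ‖v₁‖ + ‖v₂‖ with hV
  have hV0 : 0 < V := by positivity
  -- scales
  set M : ℝ := 2 * (V + 2) / ‖v₁‖ + 2 * (V + 2) / ‖v₂‖ + 1 with hM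
  have hM1 : 1 ≤ M := by
    have : 0 ≤ 2 * (V + 2) / ‖v₁‖ := by positivity
    have : 0 ≤ 2 * (V + 2) / ‖v₂‖ := by positivity
    linarith
  have hM0 : 0 < M := by linarith
  have hMv₁ : 2 * (V + 2) ≤ M * ‖v₁‖ := by
    have e : M * ‖v₁‖ = 2 * (V + 2) + (2 * (V + 2) / ‖v₂‖ + 1) * ‖v₁‖ := by
      rw [hM]; field_simp; ring
    rw [e]
    have : 0 ≤ (2 * (V + 2) / ‖v₂‖ + 1) * ‖v₁‖ := by positivity
    linarith
  have hMv₂ : 2 * (V + 2) ≤ M * ‖v₂‖ := by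
    have e : M * ‖v₂‖ = 2 * (V + 2) + (2 * (V + 2) / ‖v₁‖ + 1) * ‖v₂‖ := by
      rw [hM]; field_simp; ring
    rw [e]
    have : 0 ≤ (2 * (V + 2) / ‖v₁‖ + 1) * ‖v₂‖ := by positivity
    linarith
  set θ : ℝ := min (min 1 (min (‖v₁‖ / 2) (‖v₂‖ / 2))) (|D| / (2 * (1 + M) * V)) with hθ
  have hθ0 : 0 < θ := lt_min (lt_min one_pos (lt_min (half_pos hv₁) (half_pos hv₂)))
    (div_pos hDpos (by positivity))
  have hθ1 : θ ≤ 1 := (min_le_left _ _).trans (min_le_left _ _)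
  have hθv₁ : θ ≤ ‖v₁‖ / 2 := (min_le_left _ _).trans ((min_le_right _ _).trans (min_le_left _ _))
  have hθv₂ : θ ≤ ‖v₂‖ / 2 :=
    (min_le_left _ _).trans ((min_le_right _ _).trans (min_le_right _ _))
  have hθD : θ * (1 + M) * V < |D| := by
    have h := min_le_right (min 1 (min (‖v₁‖ / 2) (‖v₂‖ / 2))) (|D| / (2 * (1 + M) * V))
    rw [← hθ, le_div_iff₀ (by positivity)] at h
    nlinarith
  -- derivative estimates and the far zone
  obtain ⟨δ₁, hδ₁, h1est⟩ := exists_forall_norm_sub_sub_mul_le h₁ hθ0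
  obtain ⟨δ₂, hδ₂, h2est⟩ := exists_forall_norm_sub_sub_mul_le h₂ hθ0
  obtain ⟨ρ₀, hρ₀, hfar⟩ := exists_pos_forall_le_norm_sub_ends hγ hinj hδ₁ hδ₂
  -- eventual conditions
  have E0 : ∀ᶠ ε in 𝓝[>] (0 : ℝ), 0 < ε := eventually_mem_nhdsWithin
  have E1 : ∀ᶠ ε in 𝓝[>] (0 : ℝ), M * ε < δ₁ := eventually_mul_lt_nhdsGT hδ₁
  have E2 : ∀ᶠ ε in 𝓝[>] (0 : ℝ), M * ε < δ₂ := eventually_mul_lt_nhdsGT hδ₂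
  have E3 : ∀ᶠ ε in 𝓝[>] (0 : ℝ), (V + 1) * ε < ρ₀ := eventually_mul_lt_nhdsGT hρ₀
  filter_upwards [E0, E1, E2, E3] with ε hε0 hε1 hε2 hε3
  have h1lin : ∀ s, |s - a| ≤ M * ε → ‖γ s - (x + ((s - a : ℝ) : ℂ) * v₁)‖ ≤ θ * |s - a| := by
    intro s hs
    have h := h1est s (lt_of_le_of_lt hs hε1)
    convert h using 2
    rw [hx]; ring
  have h2lin : ∀ s, |s - b| ≤ M * ε → ‖γ s - (x + ((s - b : ℝ) : ℂ) * v₂)‖ ≤ θ * |s - b| := by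
    intro s hs
    have h := h2est s (lt_of_le_of_lt hs hε2)
    convert h using 2
    rw [← hloop, hx]; ring
  have hfar' : ∀ s ∈ Icc a b, M * ε ≤ s - a → M * ε ≤ b - s → ε * (V + 1) < ‖γ s - x‖ := by
    intro s hs hsa hsb
    rcases lt_or_ge (s - a) δ₁ with ha | ha
    · -- intermediate zone at `a`
      have hsabs : |s - a| = s - a := abs_of_nonneg (sub_nonneg.2 hs.1)
      have hl := h1est s (by rw [hsabs]; exact ha)
      rw [hsabs, ← hx] at hl
      have hmain : ‖((s - a : ℝ) : ℂ) * v₁‖ = (s - a) * ‖v₁‖ := by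
        rw [norm_mul, Complex.norm_real, Real.norm_eq_abs, hsabs]
      have hge : (s - a) * ‖v₁‖ - θ * (s - a) ≤ ‖γ s - x‖ := by
        have h2 := norm_sub_le_norm_sub_add_norm_sub (((s - a : ℝ) : ℂ) * v₁) (γ s - x) 0
        have h3 : ‖((s - a : ℝ) : ℂ) * v₁ - (γ s - x)‖ = ‖γ s - x - ((s - a : ℝ) : ℂ) * v₁‖ :=
          norm_sub_rev _ _
        rw [sub_zero, sub_zero, hmain, h3] at h2
        linarith
      have h4 : θ * (s - a) ≤ ‖v₁‖ / 2 * (s - a) :=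
        mul_le_mul_of_nonneg_right hθv₁ (sub_nonneg.2 hs.1)
      have h5 : M * ε * ‖v₁‖ ≤ (s - a) * ‖v₁‖ := mul_le_mul_of_nonneg_right hsa hv₁.le
      have h6 : ε * (2 * (V + 2)) ≤ ε * (M * ‖v₁‖) := mul_le_mul_of_nonneg_left hMv₁ hε0.le
      nlinarith
    rcases lt_or_ge (b - s) δ₂ with hb | hb
    · -- intermediate zone at `b`
      have hsabs : |s - b| = b - s := by rw [abs_of_nonpos (sub_nonpos.2 hs.2), neg_sub]
      have hl := h2est s (by rw [hsabs]; exact hb)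
      rw [← hloop, hsabs] at hl
      have hmain : ‖((s - b : ℝ) : ℂ) * v₂‖ = (b - s) * ‖v₂‖ := by
        rw [norm_mul, Complex.norm_real, Real.norm_eq_abs, hsabs]
      have hge : (b - s) * ‖v₂‖ - θ * (b - s) ≤ ‖γ s - x‖ := by
        have h2 := norm_sub_le_norm_sub_add_norm_sub (((s - b : ℝ) : ℂ) * v₂) (γ s - x) 0
        have h3 : ‖((s - b : ℝ) : ℂ) * v₂ - (γ s - x)‖ = ‖γ s - x - ((s - b : ℝ) : ℂ) * v₂‖ :=
          norm_sub_rev _ _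
        rw [sub_zero, sub_zero, hmain, h3] at h2
        linarith
      have h4 : θ * (b - s) ≤ ‖v₂‖ / 2 * (b - s) :=
        mul_le_mul_of_nonneg_right hθv₂ (sub_nonneg.2 hs.2)
      have h5 : M * ε * ‖v₂‖ ≤ (b - s) * ‖v₂‖ := mul_le_mul_of_nonneg_right hsb hv₂.le
      have h6 : ε * (2 * (V + 2)) ≤ ε * (M * ‖v₂‖) := mul_le_mul_of_nonneg_left hMv₂ hε0.le
      nlinarith
    · -- far zone
      have h := hfar s hs ha hb
      rw [← hx] at h
      linarith
  have hseg := segment_disjoint_of_corner_estimates hε0 hM1 hθ0.le hθ1 h1lin h2lin hfar'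
    (by rw [← hDdef]; exact hθD)
  refine ⟨hseg _ (left_mem_segment _ _ _), hseg _ (right_mem_segment _ _ _), ?_⟩
  exact wind_affine_sub_eq_of_segment hab.le hγ hloop hseg

end Literature.Topology.PlaneTopology
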